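/-
Copyright (c) 2026. All rights reserved.
Released under Apache 2.0 license as described in the file LICENSE.
Authors: abc-iut cell, prover seat abc-iut-L4-d2 (gen 9).
-/
import Mathlib.FieldTheory.Normal.Basic
import Mathlib.FieldTheory.Minpoly.Field
import Mathlib.Analysis.Complex.Polynomial.Basic
import Literature.AnabelianGeometry.AbsoluteAnabelian.GaloisTheatersNumberFieldShadowTFPairsArchModel
import Literature.AnabelianGeometry.AbsoluteAnabelian.GaloisTheatersNumberFieldShadowAutRel
import Literature.AnabelianGeometry.AbsoluteAnabelian.GaloisTheatersNumberFieldShadowTFPairsCor52iii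
import Literature.AnabelianGeometry.AbsoluteAnabelian.PanalocalTPairs
import HarnessLib

/-!
# [AbsTopIII] Def 5.1 (vi) / Cor 5.2 (vi): essential surjectivity of the panalocalization of `TF`-pairs (F-3087) at the
# print-shape `TF`-shadow vocabulary — the ARCHIMEDEAN half PROVED, the whole CONDITIONAL on local pair rigidity

S. Mochizuki, *Topics in absolute anabelian geometry III* [MochizukiAbsTopIII2015], Def 5.1 (vi) p. 118 (the panalocalization
functor `Th⊚_T → Th✠_T` "is essentially surjective"), Def 3.1 (ii) p. 67, Def 4.1 (ii) p. 102, Cor 5.2 (vi) p. 120; for the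
archimedean step cf. Def 5.1 (i) p. 113 (archimedean valuations = embeddings into `ℂ` up to conjugation).

At `fieldShadowVocabulary'' F` (abc-iut-L4-d2 g9, `…TFPairsArchModel.lean`: BOTH local-pair predicates in print shape) the named
fact `PanalocalTPairEssSurj` (F-3087) says: every panalocal `TF`-pair `M✠` is the panalocalization of a global one.  Taking for the
global pair the CANONICAL pair `M⊚_TF(Π_E)` of the theater's reference `Π_E`, the relation of Def 5.1 (vi) asks, at EVERY lift `ṽ`
of every class:
* (arc) an isomorphism of the model pair `(X_v ↶κ M_v) ≅ (ι_w : ℚ̄ ↪ ℂ)` with `(X(Π_E, ṽ) ↶ κ_{ell,ṽ})` — PROVED here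
  unconditionally: any two embeddings `ℚ̄ → ℂ` differ by an automorphism of `ℚ̄` (`ℚ̄/ℚ` is normal; Mathlib
  `Polynomial.Splits.image_rootSet`), which is absorbed in `ψ_ṽ`, while the stub orbispace isomorphism carries `A_X ≅ ℂ` freely
  (`exists_ringEquiv_embedding_comp`);
* (non) an isomorphism of the model pair `(Π_v ↷ M_v)` — a pair whose group is abstractly `≅ Π_{E,ṽ}` — with the canonical pair
  `(Π_{E,ṽ} ↷ ℚ̄)`.  This is the CONDITION "local pair rigidity" `hLPR` of the theorem below: through the model data
  `(ι : Π_v ↪ D_A ⊆ G_ℚ, ψ : M_v ≅ ℚ̄)` a pair isomorphism is a `σ ∈ G_ℚ` with `ι(Π_v) = σ · ratChart(Π_{E,ṽ}) · σ⁻¹`, so `hLPR`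
  says: OPEN SUBGROUPS OF DECOMPOSITION GROUPS OF `G_ℚ` THAT ARE ABSTRACTLY ISOMORPHIC TO `Π_{E,ṽ} ≅ D_ṽ ∩ ratChart(Π_E)` ARE
  `G_ℚ`-CONJUGATE TO IT — a local Galois rigidity statement of Jarden–Ritter type (abstractly isomorphic absolute Galois groups
  of non-isomorphic `p`-adic fields exist, so it fails for suitable `F`; at `F = ℚ` it amounts to "an open subgroup of `D_p ≅ G_{ℚ_p}`
  abstractly isomorphic to `D_p` is `D_p`", i.e. the topological invariance of `[K : ℚ_p]`, [AbsAnab] Prop 1.2.1 (ii)); it is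
  NOT asserted and NOT proved here — the theorem below is a CONDITIONAL closer.

* `exists_ringEquiv_embedding_comp` — `∀ κ₁ κ₂ : ℚ̄ →+* ℂ, ∃ σ : ℚ̄ ≃+* ℚ̄, κ₂ ∘ σ = κ₁`;
* **`panalocalTPairEssSurj_fieldShadow''_of_localPairRigidity`** — F-3087 at `fieldShadowVocabulary'' F` from `hLPR`.

HONEST LABEL: CONDITIONAL closer (the condition is a genuine number-theoretic statement about `G_ℚ`, expected to hold at `F = ℚ`
and to fail for some `F`; neither direction is proved in the tree); shadow (`Δ = 1`) ≠ the genuine `(R, W)` (E-L4-13).  No `def`/`instance`/`structure`; nothing here bears on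
[IUTchIII] Cor. 3.12 or takes a side; conditional ≠ proved.
-/

noncomputable section

open scoped Pointwise Topology
open CategoryTheory NumberField Field Polynomial

namespace Literature.AnabelianGeometry.AbsoluteAnabelian

namespace NumberFieldShadow

variable (F : Type) [Field F] [NumberField F]

/-! ### Two embeddings `ℚ̄ → ℂ` differ by an automorphism of `ℚ̄` -/

/-- **Any two field embeddings `ℚ̄ → ℂ` differ by an automorphism of `ℚ̄`**: `ℚ̄/ℚ` is normal, so for `x ∈ ℚ̄` the image
`κ₁(x)` is a complex root of `minpoly_ℚ(x)`, all of whose complex roots are `κ₂`-images of its roots in `ℚ̄`; the resulting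
`σ := κ₂⁻¹ ∘ κ₁` is a ring automorphism (archimedean valuations of `ℚ̄` are embeddings up to `Aut`).
[cite: MochizukiAbsTopIII2015, Def 5.1 (i) p.113] -/
theorem exists_ringEquiv_embedding_comp (κ₁ κ₂ : AlgebraicClosure ℚ →+* ℂ) :
    ∃ σ : AlgebraicClosure ℚ ≃+* AlgebraicClosure ℚ, ∀ x, κ₂ (σ x) = κ₁ x := by
  have hcomm : ∀ (κ : AlgebraicClosure ℚ →+* ℂ) (q : ℚ), κ (algebraMap ℚ (AlgebraicClosure ℚ) q) = algebraMap ℚ ℂ q :=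
    fun κ q => by rw [eq_ratCast (algebraMap ℚ (AlgebraicClosure ℚ)), map_ratCast, eq_ratCast]
  let f₁ : AlgebraicClosure ℚ →ₐ[ℚ] ℂ := { κ₁ with commutes' := hcomm κ₁ }
  let f₂ : AlgebraicClosure ℚ →ₐ[ℚ] ℂ := { κ₂ with commutes' := hcomm κ₂ }
  have hf₁ : ∀ x, f₁ x = κ₁ x := fun _ => rfl
  have hf₂ : ∀ x, f₂ x = κ₂ x := fun _ => rfl
  haveI halg : Algebra.IsAlgebraic ℚ (AlgebraicClosure ℚ) := AlgebraicClosure.isAlgebraic ℚ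
  have hN : Normal ℚ (AlgebraicClosure ℚ) := { toIsAlgebraic := halg, splits' := fun x => IsAlgClosed.splits _ }
  have key : ∀ (g₁ g₂ : AlgebraicClosure ℚ →ₐ[ℚ] ℂ) (x : AlgebraicClosure ℚ), ∃ y, g₂ y = g₁ x := by
    intro g₁ g₂ x
    have hmem : g₁ x ∈ (minpoly ℚ x).rootSet ℂ := by
      rw [Polynomial.mem_rootSet]
      exact ⟨minpoly.ne_zero (hN.isIntegral x), by rw [Polynomial.aeval_algHom_apply, minpoly.aeval, map_zero]⟩
    rw [← (hN.splits x).image_rootSet g₂] at hmem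
    obtain ⟨y, -, hy⟩ := hmem
    exact ⟨y, hy⟩
  choose s hs using key f₁ f₂
  choose t ht using key f₂ f₁
  have hinj₂ : Function.Injective f₂ := f₂.toRingHom.injective
  have hinj₁ : Function.Injective f₁ := f₁.toRingHom.injective
  refine ⟨{ toFun := s, invFun := t,
            left_inv := fun x => hinj₁ (by rw [ht, hs]),
            right_inv := fun x => hinj₂ (by rw [hs, ht]),
            map_mul' := fun x y => hinj₂ (by rw [hs, map_mul, map_mul, hs, hs]),
            map_add' := fun x y => hinj₂ (by rw [hs, map_add, map_add, hs, hs]) }, fun x => ?_⟩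
  change κ₂ (s x) = κ₁ x
  rw [← hf₂, hs, hf₁]

/-! ### F-3087 at the print-shape vocabulary, conditional on local pair rigidity -/

/-- **Cor 5.2 (vi) / Def 5.1 (vi), essential surjectivity (F-3087 `PanalocalTPairEssSurj`) at `fieldShadowVocabulary'' F`,
CONDITIONAL on LOCAL PAIR RIGIDITY `hLPR`** ("a model MLF-Galois `TF`-pair of the shadow whose Galois group is abstractly
isomorphic to `Π_{E,ṽ}` is isomorphic, AS A PAIR, to the canonical pair `(Π_{E,ṽ} ↷ ℚ̄)`" — equivalently: an open subgroup of a
decomposition group of `G_ℚ` abstractly isomorphic to `ratChart(Π_{E,ṽ})` is `G_ℚ`-conjugate to it; NOT asserted): every panalocal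
`TF`-pair `M✠` with reference `Π_E` is the panalocalization of the canonical global pair `M⊚_TF(Π_E)` — at nonarchimedean lifts by
`hLPR`, at archimedean lifts UNCONDITIONALLY (`exists_ringEquiv_embedding_comp`: the embedding `ι_w` of the model and `κ_{ell,ṽ}`
differ by an automorphism of `ℚ̄`, absorbed in `ψ_ṽ`; the orbispace isomorphism carries `A_X ≅ ℂ`).
[cite: MochizukiAbsTopIII2015, Def 5.1 (vi) p.118] -/
theorem panalocalTPairEssSurj_fieldShadow''_of_localPairRigidity
    (hLPR : ∀ (E : FundamentalExtension.{0}), IsAdmissible F E →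
      ∀ (v : (contextProVal E).carrier), v ∈ (contextProVal E).non →
      ∀ (D : ProfiniteGrp.{0}) (N : CommRingCat.{0}) (act : D →* Aut N),
        Nonempty ((contextProVal E).decompGrp v ≃ₜ* D) → IsShadowMLFGaloisTFPair act →
        ∃ (e : (contextProVal E).decompGrp v ≃ₜ* D) (φ : (CommRingCat.of (AlgebraicClosure ℚ) : CommRingCat.{0}) ≅ N),
          ∀ g, (fieldLocAct E v g).hom ≫ φ.hom = φ.hom ≫ (act (e g)).hom) :
    PanalocalTPairEssSurj (fieldShadowVocabulary'' F) := by
  intro Q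
  obtain ⟨E, hE, ψ, href⟩ := Q.theater.exists_reference
  have hgrp := href.2.2.2.1
  have hX := href.2.2.2.2
  -- the canonical global `TF`-pair of `Π_E` over the doubly primed vocabulary
  let M : GlobalTPair (fieldShadowVocabulary'' F) :=
    (fieldShadowVocabulary'' F).canonical E hE (isContGlob_fieldGlobAct F E)
      (fun v => isMLFGaloisPair'_fieldLocAct F hE v) (fun v => isAutHolPair''_locKummer F E v)
  refine ⟨M, Homeomorph.refl _, (context F).refl_isReferenceIsoFor E, ψ, href, fun vl hvl hc => ?_, fun vl hvl hc => ?_⟩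
  · -- nonarchimedean lifts: local pair rigidity
    obtain ⟨vl₀, hvl₀, hcl, ⟨e₀⟩⟩ := hgrp ⟨_, hc⟩
    have hcls : (context F).toModAut E vl = (context F).toModAut E vl₀ :=
      ψ.injective (hcl.symm ▸ rfl)
    obtain ⟨e₁⟩ := GlobalAnabelianContext.nonempty_decompGrp_equiv_of_toModAut_eq hcls
    exact hLPR E hE vl hvl _ _ (Q.data.actNon ⟨_, hc⟩) ⟨e₁.trans e₀.symm⟩ (Q.data.isMLF ⟨_, hc⟩)
  · -- archimedean lifts: unconditional
    obtain ⟨w, ψ', i, hi⟩ := Q.data.isAutHol ⟨_, hc⟩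
    obtain ⟨vl', -, ⟨j⟩⟩ := hX ⟨_, hc⟩
    obtain ⟨σ, hσ⟩ := exists_ringEquiv_embedding_comp (contextKappa E ⟨vl, hvl⟩) w.embedding
    refine ⟨⟨j.toHomeomorph.symm, i.symm, j.pi1Iso.symm⟩, σ.toCommRingCatIso ≪≫ ψ'.symm, ?_⟩
    change kummerTransportTF _ (σ.toCommRingCatIso ≪≫ ψ'.symm) (contextKappa E ⟨vl, hvl⟩) =
      (show (show CommRingCat.{0} from Q.data.Marc ⟨_, hc⟩) →+* (Q.theater.X ⟨_, hc⟩).fieldA from Q.data.kummer ⟨_, hc⟩)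
    refine RingHom.ext fun n => ?_
    rw [kummerTransportTF_apply]
    change i.symm (contextKappa E ⟨vl, hvl⟩ (σ.symm (ψ'.hom.hom n))) =
      (show (show CommRingCat.{0} from Q.data.Marc ⟨_, hc⟩) →+* (Q.theater.X ⟨_, hc⟩).fieldA from Q.data.kummer ⟨_, hc⟩) n
    have h1 : contextKappa E ⟨vl, hvl⟩ (σ.symm (ψ'.hom.hom n)) = w.embedding (ψ'.hom.hom n) :=
      (hσ (σ.symm (ψ'.hom.hom n))).symm.trans (congrArg w.embedding (σ.apply_symm_apply _))
    exact (congrArg i.symm (h1.trans (hi n).symm)).trans (i.symm_apply_apply _)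

end NumberFieldShadow

end Literature.AnabelianGeometry.AbsoluteAnabelian

end
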